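import Summits.Ventures.Crystal3D.Theorems.StickyWulffConstantCoaxialWallLawIncoherentBonded
import Summits.Ventures.Crystal3D.Theorems.StickyWulffConstantCoaxialWallLawIncoherentTwoGrain
import HarnessLib

/-!
# Incoherent translation pairs VIII: the EXACT FILLER LEDGER against BOTH grains' free surfaces

HONEST FRAMING. Venture `Summits/Ventures/Crystal3D` (cell `crystal3d-full`), helper `--supports` the crux
`CoaxialWallLaw` (stmt-Ventures-19481, line `WallLedgerF`, stub `stub_coaxialTwoSlabAdhesion`).  Rung credit only; F-C1
not moved.  (F-thin-comm) census-free road, step 2 (cf-p1 g28 16:48:23Z; 19481-p2 g6): the bonded ledger of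
`…IncoherentBonded` WITHOUT the hypothesis (N3) and against the two-grain count `…IncoherentTwoGrain`: for an incoherent
translation pair and ANY filling `X = X′ ⊔ F` (`X′` on the two lattices, `F` off both),
`Σ_window (12 − deg) ≥ 4φ₁·πρ² − 24(12√2π + 36R₀ + 288)ρ + Σ_{f ∈ F ∩ window} g(f)`,
`g(f) = 12 − 2·n(f) − deg_F(f)`, `n(f)` = lattice contacts, `deg_F(f)` = filler contacts — the currency of the
(F-thin-comm) PREREG (HOME/wall-19481-p2/F-THIN-COMM-PREREG-g6.md §1): registered fillers (`n ≥ 4`) are the only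
negative terms beyond `−(deg_F − 6)₊`.
* `translate_deficit_ge_incoherent_filler_twoGrain`.  WHAT THIS IS NOT: the density bound on registered fillers / the
(N4),(N5) lemmas (next); the stub; F-C1 not moved.
-/

noncomputable section

namespace Summit.Ventures.Crystal3D.Theorems

open Summit.Ventures.Crystal3D Finset NearIdentity
open Literature.MathematicalPhysics.StatisticalMechanics (fccStacking barlowStacking constHagg IsHaggSeq
  contactDeficiency)
open scoped InnerProductSpace

open scoped Classical in
/-- **Incoherent pair, bonded filler touching `≤ 3` lattice balls each: the window deficiency is the full bottom free
surface up to the fillers' EXCESS internal coordination over six.**  See the module docstring. -/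
theorem translate_deficit_ge_incoherent_filler_twoGrain
    (A : EuclideanSpace ℝ (Fin 3) ≃ₗᵢ[ℝ] EuclideanSpace ℝ (Fin 3)) (t₁ t₂ : EuclideanSpace ℝ (Fin 3))
    (hA : ∀ q ∈ fccStacking 1 (Real.sqrt (2 / 3)), ‖q + A.symm (t₂ - t₁)‖ ≠ 1)
    (X P₁ P₂ : Finset (EuclideanSpace ℝ (Fin 3))) (R₀ h ρ : ℝ)
    (hR₀ : 10 ≤ R₀) (hh : 0 ≤ h) (hρ : R₀ ≤ ρ)
    (hX : ∀ p ∈ X, ∀ q ∈ X, p ≠ q → 1 ≤ dist p q)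
    (hcell : ∀ p ∈ X, -(2 * R₀) ≤ p 2 ∧ p 2 ≤ h + 2 * R₀ ∧ p 0 ^ 2 + p 1 ^ 2 ≤ ρ ^ 2)
    (hP₁X : P₁ ⊆ X) (hP₂X : P₂ ⊆ X)
    (hP₁ : ∀ p, p ∈ P₁ ↔ (p ∈ (fun q => A q + t₁) '' fccStacking 1 (Real.sqrt (2 / 3)) ∧
      -(2 * R₀) ≤ p 2 ∧ p 2 ≤ -R₀ ∧ p 0 ^ 2 + p 1 ^ 2 ≤ ρ ^ 2))
    (hP₂ : ∀ p, p ∈ P₂ ↔ (p ∈ (fun q => A q + t₂) '' fccStacking 1 (Real.sqrt (2 / 3)) ∧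
      h + R₀ ≤ p 2 ∧ p 2 ≤ h + 2 * R₀ ∧ p 0 ^ 2 + p 1 ^ 2 ≤ ρ ^ 2))
    (F : Finset (EuclideanSpace ℝ (Fin 3))) (hFX : F ⊆ X)
    (hF : ∀ x ∈ X, x ∈ (fun q => A q + t₁) '' fccStacking 1 (Real.sqrt (2 / 3)) ∨
      x ∈ (fun q => A q + t₂) '' fccStacking 1 (Real.sqrt (2 / 3)) ∨ x ∈ F)
    (hFoff : ∀ f ∈ F, f ∉ (fun q => A q + t₁) '' fccStacking 1 (Real.sqrt (2 / 3)) ∧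
      f ∉ (fun q => A q + t₂) '' fccStacking 1 (Real.sqrt (2 / 3))) :
    2 * (2 * (Real.sqrt 2 / 4 * ∑ᶠ w ∈ {w ∈ fccStacking 1 (Real.sqrt (2 / 3)) | ‖w‖ = 1},
        |⟪w, A.symm (EuclideanSpace.single (2 : Fin 3) (1 : ℝ))⟫_ℝ|) * Real.pi * ρ ^ 2) -
        24 * (12 * Real.sqrt 2 * Real.pi + 36 * R₀ + 288) * ρ +
        ∑ f ∈ F.filter (fun z => -R₀ - 2 ≤ z 2 ∧ z 2 ≤ h + R₀ + 2),
          ((12 : ℝ) - 2 * (((X \ F).filter fun q => dist f q = 1).card : ℝ) - ((F.filter fun g => dist f g = 1).card : ℝ)) ≤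
      ∑ z ∈ X.filter (fun z => -R₀ - 2 ≤ z 2 ∧ z 2 ≤ h + R₀ + 2),
        ((12 : ℝ) - ((X.filter fun q => dist z q = 1).card : ℝ)) := by
  set Λ₁ := (fun q => A q + t₁) '' fccStacking 1 (Real.sqrt (2 / 3)) with hΛ₁
  set Λ₂ := (fun q => A q + t₂) '' fccStacking 1 (Real.sqrt (2 / 3)) with hΛ₂
  set X' := X.filter (fun x => x ∈ Λ₁ ∨ x ∈ Λ₂) with hX'
  have hX'X : X' ⊆ X := filter_subset _ _
  have hρ2 : (2 : ℝ) ≤ ρ := by linarith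
  -- `X'` misses the filler
  have hX'F : X' ⊆ X \ F := by
    intro x hx
    obtain ⟨hxX, hxΛ⟩ := mem_filter.1 hx
    refine mem_sdiff.2 ⟨hxX, fun hxF => ?_⟩
    obtain ⟨h1, h2⟩ := hFoff x hxF
    rcases hxΛ with h' | h'
    · exact h1 h'
    · exact h2 h'
  -- the rigid count on the lattice part
  have hX'sep : ∀ p ∈ X', ∀ q ∈ X', p ≠ q → 1 ≤ dist p q := fun p hp q hq => hX p (hX'X hp) q (hX'X hq)
  have hcell' : ∀ p ∈ X', -(2 * R₀) ≤ p 2 ∧ p 2 ≤ h + 2 * R₀ ∧ p 0 ^ 2 + p 1 ^ 2 ≤ ρ ^ 2 :=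
    fun p hp => hcell p (hX'X hp)
  have hP₁X' : P₁ ⊆ X' := fun p hp => mem_filter.2 ⟨hP₁X hp, Or.inl ((hP₁ p).1 hp).1⟩
  have hP₂X' : P₂ ⊆ X' := fun p hp => mem_filter.2 ⟨hP₂X hp, Or.inr ((hP₂ p).1 hp).1⟩
  have hrig : ∀ x ∈ X', x ∈ Λ₁ ∨ x ∈ Λ₂ := fun x hx => (mem_filter.1 hx).2
  have hcount := translate_deficit_ge_incoherent_rigid_twoGrain A t₁ t₂ hA X' P₁ P₂ R₀ h ρ hR₀ hh hρ hX'sep hcell' hP₁X'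
    hP₂X' hP₁ hP₂ hrig
  -- windows and rim bands
  set W := X.filter (fun z => -R₀ - 2 ≤ z 2 ∧ z 2 ≤ h + R₀ + 2) with hW
  set W' := X'.filter (fun z => -R₀ - 2 ≤ z 2 ∧ z 2 ≤ h + R₀ + 2) with hW'
  set WF := F.filter (fun z => -R₀ - 2 ≤ z 2 ∧ z 2 ≤ h + R₀ + 2) with hWF
  have hW'W : W' ⊆ W := fun z hz => mem_filter.2 ⟨hX'X (mem_filter.1 hz).1, (mem_filter.1 hz).2⟩
  have hWFW : WF ⊆ W := fun z hz => mem_filter.2 ⟨hFX (mem_filter.1 hz).1, (mem_filter.1 hz).2⟩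
  have hdisjW : Disjoint W' WF := by
    rw [Finset.disjoint_left]
    intro z hz hz'
    exact (mem_sdiff.1 (hX'F (mem_filter.1 hz).1)).2 (mem_filter.1 hz').1
  set Bt := X.filter fun s => h + R₀ + 2 ≤ s 2 ∧ s 2 ≤ h + R₀ + 2 + 1 ∧ (ρ - 2) ^ 2 < s 0 ^ 2 + s 1 ^ 2 with hBt
  set Bb := X.filter fun s => -R₀ - 3 ≤ s 2 ∧ s 2 ≤ -R₀ - 3 + 1 ∧ (ρ - 2) ^ 2 < s 0 ^ 2 + s 1 ^ 2 with hBb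
  have hrim : ∀ (lo : ℝ) (B : Finset (EuclideanSpace ℝ (Fin 3))),
      B = X.filter (fun s => lo ≤ s 2 ∧ s 2 ≤ lo + 1 ∧ (ρ - 2) ^ 2 < s 0 ^ 2 + s 1 ^ 2) → (B.card : ℝ) ≤ 144 * ρ := by
    intro lo B hBdef
    have hsep : ∀ p ∈ B, ∀ q ∈ B, p ≠ q → 1 ≤ dist p q := fun p hp q hq hpq =>
      hX p (by rw [hBdef] at hp; exact (mem_filter.1 hp).1) q (by rw [hBdef] at hq; exact (mem_filter.1 hq).1) hpq
    have hmem : ∀ p ∈ B, lo ≤ p 2 ∧ p 2 ≤ lo + 1 ∧ (ρ - 2) ^ 2 < p 0 ^ 2 + p 1 ^ 2 ∧ p 0 ^ 2 + p 1 ^ 2 ≤ ρ ^ 2 := by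
      intro p hp
      rw [hBdef] at hp
      obtain ⟨hpX, h1, h2, h3⟩ := mem_filter.1 hp
      exact ⟨h1, h2, h3, (hcell p hpX).2.2⟩
    have key := card_mul_le_of_separated_in_shell B hsep lo (lo + 1) (ρ - 2) ρ (by linarith) (by linarith)
      (by linarith) hmem
    have e : (lo + 1 - lo + 2) * (Real.pi * (ρ + 1) ^ 2 - Real.pi * (ρ - 2 - 1) ^ 2) =
        (Real.pi / 6) * (144 * ρ - 144) := by ring
    rw [e] at key
    have hπ : 0 < Real.pi / 6 := by positivity
    have := le_of_mul_le_mul_right (by linarith [key] : (B.card : ℝ) * (Real.pi / 6) ≤ (144 * ρ - 144) * (Real.pi / 6)) hπ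
    linarith
  have hBt : (Bt.card : ℝ) ≤ 144 * ρ := hrim (h + R₀ + 2) Bt rfl
  have hBb : (Bb.card : ℝ) ≤ 144 * ρ := hrim (-R₀ - 3) Bb rfl
  -- completeness of the two samples in the form `not_mem_interior_of_complete` wants
  have hcomp₂ := fun y (hy : y ∈ Λ₂) (h1 : h + R₀ ≤ y 2) (h2 : y 2 ≤ h + 2 * R₀) (h3 : y 0 ^ 2 + y 1 ^ 2 ≤ ρ ^ 2) =>
    hP₂X ((hP₂ y).2 ⟨hy, h1, h2, h3⟩)
  have hcomp₁ := fun y (hy : y ∈ Λ₁) (h1 : -(2 * R₀) ≤ y 2) (h2 : y 2 ≤ -R₀) (h3 : y 0 ^ 2 + y 1 ^ 2 ≤ ρ ^ 2) =>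
    hP₁X ((hP₁ y).2 ⟨hy, h1, h2, h3⟩)
  -- (1) degrees in `X` vs `X'` plus filler contacts
  have hdeg : ∀ z, ((X.filter fun q => dist z q = 1).card : ℝ) ≤
      ((X'.filter fun q => dist z q = 1).card : ℝ) + ((F.filter fun q => dist z q = 1).card : ℝ) := by
    intro z
    have hsub : (X.filter fun q => dist z q = 1) ⊆ (X'.filter fun q => dist z q = 1) ∪ (F.filter fun q => dist z q = 1) := by
      intro q hq
      obtain ⟨hqX, hd⟩ := mem_filter.1 hq
      rcases hF q hqX with h' | h' | h'
      · exact mem_union_left _ (mem_filter.2 ⟨mem_filter.2 ⟨hqX, Or.inl h'⟩, hd⟩)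
      · exact mem_union_left _ (mem_filter.2 ⟨mem_filter.2 ⟨hqX, Or.inr h'⟩, hd⟩)
      · exact mem_union_right _ (mem_filter.2 ⟨h', hd⟩)
    exact_mod_cast (card_le_card hsub).trans (card_union_le _ _)
  -- (2) a filler ball's lattice contacts: `X' = X ∖ F`
  have hX'eq : X' = X \ F := by
    refine Subset.antisymm hX'F fun x hx => ?_
    obtain ⟨hxX, hxF⟩ := mem_sdiff.1 hx
    rcases hF x hxX with h' | h' | h'
    · exact mem_filter.2 ⟨hxX, Or.inl h'⟩
    · exact mem_filter.2 ⟨hxX, Or.inr h'⟩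
    · exact absurd h' hxF
  have hNW : ∀ f ∈ F, ((W'.filter fun z => dist z f = 1).card : ℝ) ≤ (((X \ F).filter fun q => dist f q = 1).card : ℝ) := by
    intro f hf
    have hsub : (W'.filter fun z => dist z f = 1) ⊆ ((X \ F).filter fun q => dist f q = 1) := by
      intro z hz
      obtain ⟨hzW', hdz⟩ := mem_filter.1 hz
      exact mem_filter.2 ⟨hX'F (mem_filter.1 hzW').1, by rw [dist_comm]; exact hdz⟩
    exact_mod_cast card_le_card hsub
  have hN12 : ∀ f ∈ F, ((W'.filter fun z => dist z f = 1).card : ℝ) ≤ 12 := by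
    intro f hf
    have hsub : (W'.filter fun z => dist z f = 1) ⊆ (X.filter fun q => dist f q = 1) := by
      intro z hz
      obtain ⟨hzW', hdz⟩ := mem_filter.1 hz
      exact mem_filter.2 ⟨hX'X (mem_filter.1 hzW').1, by rw [dist_comm]; exact hdz⟩
    exact_mod_cast (card_le_card hsub).trans (card_filter_dist_eq_one_le_twelve X hX f)
  have hN' : ∀ f ∈ F, ((X'.filter fun q => dist f q = 1).card : ℝ) = (((X \ F).filter fun q => dist f q = 1).card : ℝ) := by
    intro f hf; rw [hX'eq]
  -- fillers adjacent to the window but outside it are rim balls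
  have hadj : ∀ f ∈ F, (W'.filter fun z => dist z f = 1) ≠ ∅ → f ∉ WF → f ∈ Bt ∪ Bb := by
    intro f hf hne hfW
    obtain ⟨z, hz⟩ := nonempty_iff_ne_empty.2 hne
    obtain ⟨hzW', hdz⟩ := mem_filter.1 hz
    obtain ⟨-, hz1, hz2⟩ := mem_filter.1 hzW'
    obtain ⟨hf₁, hf₂⟩ := hFoff f hf
    have hfX := hFX hf
    have hfz : |(f - z) 2| ≤ 1 := by
      have h1' : |(f - z) 2| ≤ ‖f - z‖ := by
        rw [apply_two_eq_inner_e₃]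
        calc |⟪f - z, EuclideanSpace.single (2 : Fin 3) (1 : ℝ)⟫_ℝ|
            ≤ ‖f - z‖ * ‖(EuclideanSpace.single (2 : Fin 3) (1 : ℝ) : EuclideanSpace ℝ (Fin 3))‖ :=
              abs_real_inner_le_norm _ _
          _ = ‖f - z‖ := by rw [PiLp.norm_single, norm_one, mul_one]
      rw [← dist_eq_norm, dist_comm, hdz] at h1'; exact h1'
    rw [PiLp.sub_apply] at hfz
    obtain ⟨hfza, hfzb⟩ := abs_le.1 hfz
    have hnotW : ¬ (-R₀ - 2 ≤ f 2 ∧ f 2 ≤ h + R₀ + 2) := fun hw => hfW (mem_filter.2 ⟨hf, hw⟩)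
    by_cases hrad : (ρ - 2) ^ 2 < f 0 ^ 2 + f 1 ^ 2
    · by_cases htop : h + R₀ + 2 ≤ f 2
      · exact mem_union_left _ (mem_filter.2 ⟨hfX, htop, by linarith, hrad⟩)
      · push Not at htop
        have hbot : f 2 < -R₀ - 2 := by
          by_contra h'; push Not at h'; exact hnotW ⟨h', htop.le⟩
        exact mem_union_right _ (mem_filter.2 ⟨hfX, by linarith, by linarith, hrad⟩)
    · exfalso
      push Not at hrad
      by_cases htop : h + R₀ + 2 ≤ f 2
      · exact not_mem_interior_of_complete A t₂ X hX hcomp₂ hρ2 hfX hf₂ (by linarith) (by linarith) hrad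
      · push Not at htop
        have hbot : f 2 < -R₀ - 2 := by
          by_contra h'; push Not at h'; exact hnotW ⟨h', htop.le⟩
        exact not_mem_interior_of_complete A t₁ X hX hcomp₁ hρ2 hfX hf₁ (by linarith [(hcell f hfX).1]) (by linarith) hrad
  -- (3) the filler contacts of the window, double counted
  have hfill : ∑ z ∈ W', ((F.filter fun q => dist z q = 1).card : ℝ) ≤
      ∑ f ∈ WF, (((X \ F).filter fun q => dist f q = 1).card : ℝ) + 12 * ((Bt ∪ Bb).card : ℝ) := by
    have e1 : ∀ z ∈ W', ((F.filter fun q => dist z q = 1).card : ℝ) = ∑ f ∈ F, if dist z f = 1 then (1 : ℝ) else 0 := by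
      intro z _; rw [← sum_filter]; simp
    rw [sum_congr rfl e1, sum_comm]
    have e2 : ∀ f ∈ F, (∑ z ∈ W', if dist z f = 1 then (1 : ℝ) else 0) = ((W'.filter fun z => dist z f = 1).card : ℝ) := by
      intro f _; rw [← sum_filter]; simp
    rw [sum_congr rfl e2]
    have hle : ∀ f ∈ F, ((W'.filter fun z => dist z f = 1).card : ℝ) ≤
        (if f ∈ WF then (((X \ F).filter fun q => dist f q = 1).card : ℝ) else 0) + (if f ∈ Bt ∪ Bb then 12 else 0) := by
      intro f hf
      by_cases hne : (W'.filter fun z => dist z f = 1) = ∅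
      · rw [hne, card_empty, Nat.cast_zero]
        have h1 : (0 : ℝ) ≤ if f ∈ WF then (((X \ F).filter fun q => dist f q = 1).card : ℝ) else 0 := by
          split_ifs
          · exact Nat.cast_nonneg _
          · norm_num
        have h2 : (0 : ℝ) ≤ if f ∈ Bt ∪ Bb then 12 else 0 := by split_ifs <;> norm_num
        linarith
      · by_cases hfW : f ∈ WF
        · rw [if_pos hfW]
          have h2 : (0 : ℝ) ≤ if f ∈ Bt ∪ Bb then 12 else 0 := by split_ifs <;> norm_num
          linarith [hNW f hf]
        · rw [if_neg hfW, if_pos (hadj f hf hne hfW)]; linarith [hN12 f hf]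
    refine (sum_le_sum hle).trans ?_
    rw [sum_add_distrib]
    have s1 : ∑ f ∈ F, (if f ∈ WF then (((X \ F).filter fun q => dist f q = 1).card : ℝ) else 0) =
        ∑ f ∈ WF, (((X \ F).filter fun q => dist f q = 1).card : ℝ) := by
      rw [← sum_filter]
      have : F.filter (fun f => f ∈ WF) = WF := by
        ext f; rw [mem_filter, hWF, mem_filter]; tauto
      rw [this]
    have s2 : ∑ f ∈ F, (if f ∈ Bt ∪ Bb then (12 : ℝ) else 0) ≤ 12 * ((Bt ∪ Bb).card : ℝ) := by
      rw [← sum_filter, sum_const, nsmul_eq_mul, mul_comm]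
      have : (F.filter fun f => f ∈ Bt ∪ Bb).card ≤ (Bt ∪ Bb).card :=
        card_le_card fun f hf => (mem_filter.1 hf).2
      have : ((F.filter fun f => f ∈ Bt ∪ Bb).card : ℝ) ≤ ((Bt ∪ Bb).card : ℝ) := by exact_mod_cast this
      linarith
    linarith
  have hBtb : ((Bt ∪ Bb).card : ℝ) ≤ 288 * ρ := by
    have : ((Bt ∪ Bb).card : ℝ) ≤ (Bt.card : ℝ) + (Bb.card : ℝ) := by exact_mod_cast card_union_le Bt Bb
    linarith
  -- (4) the fillers' own deficiency inside the window: `12 − deg f ≥ 12 − n f − deg_F f`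
  have hown : ∀ f ∈ WF, (12 : ℝ) - (((X \ F).filter fun q => dist f q = 1).card : ℝ) -
      ((F.filter fun g => dist f g = 1).card : ℝ) ≤ (12 : ℝ) - ((X.filter fun q => dist f q = 1).card : ℝ) := by
    intro f hfW
    have hf : f ∈ F := (mem_filter.1 hfW).1
    have hd := hdeg f
    rw [hN' f hf] at hd
    linarith
  -- (5) assemble
  have hsumW' : ∑ z ∈ W', ((12 : ℝ) - ((X'.filter fun q => dist z q = 1).card : ℝ)) ≤
      ∑ z ∈ W', ((12 : ℝ) - ((X.filter fun q => dist z q = 1).card : ℝ)) +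
        ∑ z ∈ W', ((F.filter fun q => dist z q = 1).card : ℝ) := by
    rw [← sum_add_distrib]
    exact sum_le_sum fun z _ => by linarith [hdeg z]
  have hsplitW : ∑ z ∈ W', ((12 : ℝ) - ((X.filter fun q => dist z q = 1).card : ℝ)) +
      ∑ f ∈ WF, ((12 : ℝ) - ((X.filter fun q => dist f q = 1).card : ℝ)) ≤
      ∑ z ∈ W, ((12 : ℝ) - ((X.filter fun q => dist z q = 1).card : ℝ)) := by
    rw [← sum_union hdisjW]
    refine sum_le_sum_of_subset_of_nonneg (union_subset hW'W hWFW) fun z _ _ => ?_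
    have := card_filter_dist_eq_one_le_twelve X hX z
    have : ((X.filter fun q => dist z q = 1).card : ℝ) ≤ 12 := by exact_mod_cast this
    linarith
  have hownS := sum_le_sum hown
  have e288 : 24 * (12 * Real.sqrt 2 * Real.pi + 36 * R₀ + 288) * ρ =
      24 * (12 * Real.sqrt 2 * Real.pi + 36 * R₀ + 144) * ρ + 12 * (288 * ρ) := by ring
  rw [e288]
  have hsplit2 : ∑ f ∈ WF, ((12 : ℝ) - 2 * (((X \ F).filter fun q => dist f q = 1).card : ℝ) -
      ((F.filter fun g => dist f g = 1).card : ℝ)) =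
      ∑ f ∈ WF, ((12 : ℝ) - (((X \ F).filter fun q => dist f q = 1).card : ℝ) -
        ((F.filter fun g => dist f g = 1).card : ℝ)) - ∑ f ∈ WF, (((X \ F).filter fun q => dist f q = 1).card : ℝ) := by
    rw [← sum_sub_distrib]; refine sum_congr rfl fun f _ => ?_; ring
  rw [hsplit2]
  linarith [hcount, hfill, hBtb, hsumW', hsplitW, hownS]

end Summit.Ventures.Crystal3D.Theorems

end
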